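/-
Width seat `ym-line-cbag-p1-w2` (prover-ym-line-cbag-p1-w2-g2-0; own items 22254/22893 closed), route `ColdBoxAllGroups`, helping crux
`BulkAllGroups` (stmt-QuantumFields-22255), line `dlr-chessboard-G` (lead `ym-line-cbag-p2`): R1/R3 with datum and the TILT BOUND
WITH DATUM T4 in the lead's datum vocabulary `…ColdBoxAllGroupsOneScaleDatumDefsG` / `…BulkAllGroupsDatumSplitG` — G-port of
`…ColdBoxTiltBoundDatum` §2.
-/
import Summits.QuantumFields.YangMills.Theorems.ColdBoxAllGroupsBulkAllGroupsDatumSplitG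
import Summits.QuantumFields.YangMills.Theorems.ColdBoxAllGroupsBulkAllGroupsLinkSmallDatumG
import Summits.QuantumFields.YangMills.Theorems.ColdBoxAllGroupsBulkAllGroupsLinearisedDatumEnergyG

/-!
# Crux `BulkAllGroups` (stmt-QuantumFields-22255), stubs N2-cov-G / N2-mean-G: small chart coordinates and the tilt bound with an
# exterior datum (T4), every compact group presented in `U(N)`

ϑ-twin of the BOX line's brick B7 «TiltBoundG» (`Theorems/ColdBoxAllGroupsBoxFloorAllGroupsTiltBoundG.lean`), i.e. the G-port of
`WeakCouplingRates.sum_sq_extDatum_le_of_mem_goodTD` / `abs_beta_mul_plaqCostAt_sub_qObsD_le_of_mem_goodTD` / `abs_tiltWD_le_of_mem_goodTD` /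
`beta_mul_plaqCostAt_mem_Icc_of_mem_goodTD` (`…ColdBoxTiltBoundDatum` §2), in the lead's datum objects (`datVec`, `sdatE β ϑ c = √β•ϑ c`, `meanTE`,
`cfgTDE`, `qObsDE`, `goodTDE`, `tiltWDE`; `D = dimE ρ` colours, exponential chart `ψ = expChart ρ`).  Write
`a_t = extDatum (datVec ϑ) (unscaleTE H D β (t + μ'))` for the chart coordinates of `cfgTDE ρ H β ϑ t` (`cfgTDE … t e = ψ(a_t e)`).

* (T2a — the circulation split `β·Σ_c sCirc((a_t)_c)(p)² = 2·qObsDE p t` on touching plaquettes — is the lead's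
  `beta_mul_sum_sCirc_extDatum_sq_eqE`, module `…BulkAllGroupsDatumSplitG`, imported.)
* R1 with datum **`norm_extDatum_le_of_mem_goodTDE`** — for `t ∈ goodTDE` inside the chart window (`‖unscaleTE (t+μ') e‖ ≤ 1/16` on the free links,
  exterior datum `Σ_c ϑ_{c,e}² ≤ r²` off the box with `r ≤ 1/16`, `ϑ = 0` on the forest): every chart coordinate has
  `‖a_t e‖ ≤ 2(12H²+2H+1)(√2·√(β^{2ε−1}) + 8r)` (brick `norm_chart_le_of_mem_coldGoodSetG_of_exterior_le`);
* R3 with datum **`abs_beta_mul_plaqCostAt_sub_qObsDE_le`** — if every `‖a_t e‖ ≤ m ≤ 1/4` then for every plaquette `p` touching the box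
  `|β·cost_p(cfgTDE t) − qObsDE p t| ≤ 190·β·m³` (brick «CubicG» via w3's `abs_plaqCostAt_sub_half_sum_sq_le_of_eq_expChart`);
* T4 **`abs_tiltWDE_le`** — with a chart density `g` satisfying `|log g(a)| ≤ ℓ` for `‖a‖ ≤ m`:
  `|tiltWDE ρ H g β ϑ t| ≤ #(plaquettesTouching Λ)·190·β·m³ + #(ColdFreeIdx H)·ℓ`; `abs_tiltWDE_le_of_mem_goodTDE` — the same on `goodTDE` with
  `m = 2(12H²+2H+1)(√2·√(β^{2ε−1}) + 8r)` from R1;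
* `beta_mul_plaqCostAt_lt_of_mem_goodTDE` / `…_mem_Icc_…` — on `goodTDE`, `0 ≤ β·cost_p(cfgTDE t) < β^{2ε}` for touching `p`.
No sorry; no definition; standard axioms.  NOT a claim about the mass gap: rung-level support (R2xi-G `XiPow`, RECORD label); the Yang–Mills
mass gap is NOT proved by any of this.
-/

set_option autoImplicit false

noncomputable section

open MeasureTheory Finset
open scoped Matrix.Norms.Frobenius
open Literature.Probability.LatticeModels (Site)
open Literature.MathematicalPhysics.QuantumLattice
open Literature.MathematicalPhysics.QuantumFieldTheory
open Literature.MathematicalPhysics.QuantumFieldTheory.LatticeMaxwell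
open Literature.MathematicalPhysics.QuantumFieldTheory.AxialGauge
open Summit.QuantumFields.YangMills.Theorems.WeakCouplingRates
open Summit.QuantumFields.YangMills.Theorems.FreeEnergyLogCoefficient

namespace Summit.QuantumFields.YangMills.Theorems.ColdBoxAllGroups

variable {N : ℕ} {G : Type} [Group G] (ρ : G →* Matrix (Fin N) (Fin N) ℂ) {H : ℕ}

/-! ## R1 with datum: the chart coordinates of `cfgTDE t` are uniformly small on the small-field event -/

section Chart

variable [TopologicalSpace G] [CompactSpace G] (hρu : ∀ g, ρ g ∈ Matrix.unitaryGroup (Fin N) ℂ)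

omit [TopologicalSpace G] [CompactSpace G] in
/-- `cfgTDE t` is the configuration of chart points of its coordinates `a_t` (definitional). -/
theorem cfgTDE_eq_expChart_extDatum (β : ℝ) (ϑ : Fin (dimE ρ) → (Literature.MathematicalPhysics.QuantumLattice.ZdEdge 4 → ℝ))
    (t : TSpaceD H (dimE ρ)) :
    cfgTDE ρ H β ϑ t = fun e => expChart ρ (extDatum (datVec ϑ) (unscaleTE H (dimE ρ) β (t + meanTE H (dimE ρ) β ϑ)) e) := rfl

omit [TopologicalSpace G] [CompactSpace G] in
/-- The a-priori chart window: if the exterior datum has `Σ_c ϑ_{c,e}² ≤ r²` with `r ≤ 1/16` and the free-link data satisfy `‖w e‖ ≤ 1/16`,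
then every coordinate `extDatum (datVec ϑ) w e` has norm `≤ 1/16` (forest coordinates are `0` by construction). -/
theorem norm_extDatum_le_sixteenth (ϑ : Fin (dimE ρ) → (Literature.MathematicalPhysics.QuantumLattice.ZdEdge 4 → ℝ))
    (w : ColdFreeIdx H → EuclideanSpace ℝ (Fin (dimE ρ))) {r : ℝ} (hr : 0 ≤ r) (hr16 : r ≤ 1 / 16)
    (hϑ : ∀ e, e ∉ boxEdges 4 (2 * H + 1) → ∑ c, ϑ c e ^ 2 ≤ r ^ 2)
    (hw : ∀ e, ‖w e‖ ≤ 1 / 16) (e : Literature.MathematicalPhysics.QuantumLattice.ZdEdge 4) :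
    ‖extDatum (datVec ϑ) w e‖ ≤ 1 / 16 := by
  by_cases hΛ : e ∈ boxEdges 4 (2 * H + 1)
  · by_cases hf : (e.2 = 0 ∧ ∀ k : Fin 4, 1 ≤ e.1 k ∧ e.1 k + 1 ≤ 2 * (H : ℤ))
    · obtain ⟨x, j⟩ := e
      obtain ⟨hj, hx⟩ := hf
      simp only at hj hx
      subst hj
      rw [extDatum_of_forest _ _ hx, norm_zero]; norm_num
    · have := extDatum_apply_free (datVec ϑ) w ⟨⟨e, hΛ⟩, hf⟩
      rw [this]; exact hw _
  · rw [extDatum_of_not_mem _ _ hΛ]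
    exact (norm_datVec_le ϑ hr (hϑ e hΛ)).trans hr16

omit [TopologicalSpace G] [CompactSpace G] in
/-- Exterior coordinates of `extDatum (datVec ϑ) w`: `‖·‖ ≤ r` off the box. -/
theorem norm_extDatum_le_of_not_mem (ϑ : Fin (dimE ρ) → (Literature.MathematicalPhysics.QuantumLattice.ZdEdge 4 → ℝ))
    (w : ColdFreeIdx H → EuclideanSpace ℝ (Fin (dimE ρ))) {r : ℝ} (hr : 0 ≤ r)
    (hϑ : ∀ e, e ∉ boxEdges 4 (2 * H + 1) → ∑ c, ϑ c e ^ 2 ≤ r ^ 2)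
    {e : Literature.MathematicalPhysics.QuantumLattice.ZdEdge 4} (he : e ∉ boxEdges 4 (2 * H + 1)) :
    ‖extDatum (datVec ϑ) w e‖ ≤ r := by
  rw [extDatum_of_not_mem _ _ he]; exact norm_datVec_le ϑ hr (hϑ e he)

omit [TopologicalSpace G] [CompactSpace G] in
/-- Forest coordinates of `extDatum (datVec ϑ) w` vanish. -/
theorem extDatum_datVec_of_forest (ϑ : Fin (dimE ρ) → (Literature.MathematicalPhysics.QuantumLattice.ZdEdge 4 → ℝ))
    (w : ColdFreeIdx H → EuclideanSpace ℝ (Fin (dimE ρ))) {x : Site 4} (hx : ∀ k : Fin 4, 1 ≤ x k ∧ x k + 1 ≤ 2 * (H : ℤ)) :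
    extDatum (H := H) (datVec ϑ) w (x, 0) = 0 :=
  extDatum_of_forest _ _ hx

include hρu in
/-- **R1 with datum on `goodTDE`**: for a faithful continuous unitary `ρ`, `β > 0`, `H ≥ 1`, an exterior datum with `Σ_c ϑ_{c,e}² ≤ r²` off the box
(`0 ≤ r ≤ 1/16`), and `t ∈ goodTDE` inside the chart window (`‖unscaleTE (t + μ') e‖ ≤ 1/16` on the free links), EVERY chart coordinate of
`cfgTDE t` has `‖a_t e‖ ≤ 2·(12H²+2H+1)·(√2·√(β^{2ε−1}) + 8r)` (forest coordinates are `0` by construction of `extDatum`). -/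
theorem norm_extDatum_le_of_mem_goodTDE (hρ : Continuous ρ) (hinj : Function.Injective ρ) (hH : 1 ≤ H) {β ε r : ℝ} (hβ : 0 < β)
    (hr : 0 ≤ r) (hr16 : r ≤ 1 / 16) {ϑ : Fin (dimE ρ) → (Literature.MathematicalPhysics.QuantumLattice.ZdEdge 4 → ℝ)}
    (hϑ : ∀ e, e ∉ boxEdges 4 (2 * H + 1) → ∑ c, ϑ c e ^ 2 ≤ r ^ 2)
    {t : TSpaceD H (dimE ρ)} (hwin : ∀ e : ColdFreeIdx H, ‖unscaleTE H (dimE ρ) β (t + meanTE H (dimE ρ) β ϑ) e‖ ≤ 1 / 16)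
    (ht : t ∈ goodTDE ρ H β ε ϑ) (e : Literature.MathematicalPhysics.QuantumLattice.ZdEdge 4) :
    ‖extDatum (datVec ϑ) (unscaleTE H (dimE ρ) β (t + meanTE H (dimE ρ) β ϑ)) e‖ ≤
      2 * ((12 * (H : ℝ) ^ 2 + 2 * H + 1) * (Real.sqrt 2 * Real.sqrt (β ^ (2 * ε - 1)) + 8 * r)) := by
  set w := unscaleTE H (dimE ρ) β (t + meanTE H (dimE ρ) β ϑ) with hw
  refine norm_chart_le_of_mem_coldGoodSetG_of_exterior_le ρ hρu hρ hinj hH hβ (extDatum (datVec ϑ) w) hr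
    (norm_extDatum_le_sixteenth ρ ϑ w hr hr16 hϑ hwin)
    (fun e he => norm_extDatum_le_of_not_mem ρ ϑ w hr hϑ he)
    (fun x hx => extDatum_datVec_of_forest ρ ϑ w hx) ?_ e
  exact (mem_goodTDE_iff ρ β ε ϑ t).1 ht

/-! ## R3 with datum: the cubic remainder per touching plaquette -/

/-- **R3 with datum**: if every chart coordinate of `cfgTDE t` has norm `≤ m ≤ 1/4` (continuous unitary-valued `ρ`, `β > 0`, `ϑ = 0` on the
temporal forest), then for every plaquette `p` touching the cold box `|β·cost_p(cfgTDE t) − qObsDE p t| ≤ 190·β·m³`. -/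
theorem abs_beta_mul_plaqCostAt_sub_qObsDE_le (hρ : Continuous ρ) {β m : ℝ} (hβ : 0 < β) (hm : m ≤ 1 / 4)
    {ϑ : Fin (dimE ρ) → (Literature.MathematicalPhysics.QuantumLattice.ZdEdge 4 → ℝ)}
    (hforest : ∀ x : Site 4, (∀ k : Fin 4, 1 ≤ x k ∧ x k + 1 ≤ 2 * (H : ℤ)) → ∀ c, ϑ c (x, 0) = 0)
    (t : TSpaceD H (dimE ρ))
    (ha : ∀ e, ‖extDatum (datVec ϑ) (unscaleTE H (dimE ρ) β (t + meanTE H (dimE ρ) β ϑ)) e‖ ≤ m)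
    {p : ZdPlaquette 4} (hp : p ∈ plaquettesTouching (boxEdges 4 (2 * H + 1))) :
    |β * plaqCostAt ρ p.1 p.2.1.1 p.2.1.2 (cfgTDE ρ H β ϑ t) - qObsDE H (dimE ρ) β ϑ (p.1, p.2.1.1, p.2.1.2) t| ≤ 190 * β * m ^ 3 := by
  set a := extDatum (datVec ϑ) (unscaleTE H (dimE ρ) β (t + meanTE H (dimE ρ) β ϑ)) with hadef
  have key := abs_plaqCostAt_sub_half_sum_sq_le_of_eq_expChart ρ hρ (cfgTDE ρ H β ϑ t) a p.1 p.2.1.1 p.2.1.2 hm rfl rfl rfl rfl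
    (ha _) (ha _) (ha _) (ha _)
  have hq : qObsDE H (dimE ρ) β ϑ (p.1, p.2.1.1, p.2.1.2) t =
      β * ((1 / 2 : ℝ) * ∑ c, (sCirc (fun e => a e c) (p.1, p.2.1.1, p.2.1.2)) ^ 2) := by
    have h := beta_mul_sum_sCirc_extDatum_sq_eqE hβ ϑ hforest t hp
    rw [← hadef] at h
    linarith
  rw [hq, ← mul_sub, abs_mul, abs_of_pos hβ]
  calc β * |_| ≤ β * (190 * m ^ 3) := mul_le_mul_of_nonneg_left key hβ.le
    _ = 190 * β * m ^ 3 := by ring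

/-! ## T4 — the tilt exponent with datum is uniformly small -/

/-- **T4 — the tilt with datum is small** (continuous unitary-valued `ρ`, `β > 0`, `ϑ = 0` on the temporal forest): if every chart coordinate of
`cfgTDE t` has norm `≤ m ≤ 1/4` and the chart density satisfies `|log g(a)| ≤ ℓ` for `‖a‖ ≤ m`, then
`|tiltWDE ρ H g β ϑ t| ≤ #(plaquettesTouching Λ)·190·β·m³ + #(ColdFreeIdx H)·ℓ`.  At `ϑ = 0` this is B7 `abs_tiltWE_le`. -/
theorem abs_tiltWDE_le (hρ : Continuous ρ) {β m ℓ : ℝ} (hβ : 0 < β) (hm : m ≤ 1 / 4)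
    {g : EuclideanSpace ℝ (Fin (dimE ρ)) → ℝ} (hg : ∀ a, ‖a‖ ≤ m → |Real.log (g a)| ≤ ℓ)
    {ϑ : Fin (dimE ρ) → (Literature.MathematicalPhysics.QuantumLattice.ZdEdge 4 → ℝ)}
    (hforest : ∀ x : Site 4, (∀ k : Fin 4, 1 ≤ x k ∧ x k + 1 ≤ 2 * (H : ℤ)) → ∀ c, ϑ c (x, 0) = 0)
    (t : TSpaceD H (dimE ρ))
    (ha : ∀ e, ‖extDatum (datVec ϑ) (unscaleTE H (dimE ρ) β (t + meanTE H (dimE ρ) β ϑ)) e‖ ≤ m) :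
    |tiltWDE ρ H g β ϑ t| ≤
      #(plaquettesTouching (boxEdges 4 (2 * H + 1))) * (190 * β * m ^ 3) + Fintype.card (ColdFreeIdx H) * ℓ := by
  unfold tiltWDE
  refine (abs_add_le _ _).trans (add_le_add ?_ ?_)
  · refine (Finset.abs_sum_le_sum_abs _ _).trans ?_
    calc ∑ q ∈ plaquettesTouching (boxEdges 4 (2 * H + 1)),
          |qObsDE H (dimE ρ) β ϑ (q.1, q.2.1.1, q.2.1.2) t - β * plaqCostAt ρ q.1 q.2.1.1 q.2.1.2 (cfgTDE ρ H β ϑ t)|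
        ≤ ∑ _q ∈ plaquettesTouching (boxEdges 4 (2 * H + 1)), 190 * β * m ^ 3 :=
          Finset.sum_le_sum fun q hq => by
            rw [abs_sub_comm]; exact abs_beta_mul_plaqCostAt_sub_qObsDE_le ρ hρ hβ hm hforest t ha hq
      _ = _ := by rw [Finset.sum_const, nsmul_eq_mul]
  · refine (Finset.abs_sum_le_sum_abs _ _).trans ?_
    calc ∑ e : ColdFreeIdx H, |Real.log (g (unscaleTE H (dimE ρ) β (t + meanTE H (dimE ρ) β ϑ) e))|
        ≤ ∑ _e : ColdFreeIdx H, ℓ := Finset.sum_le_sum fun e _ => hg _ (by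
            have := ha e.1.1
            rwa [extDatum_apply_free] at this)
      _ = _ := by rw [Finset.sum_const, nsmul_eq_mul, Finset.card_univ]

include hρu in
/-- **T4 on `goodTDE`**: for a faithful continuous unitary `ρ`, `β > 0`, `H ≥ 1`, an exterior datum with `Σ_c ϑ_{c,e}² ≤ r²` off the box
(`0 ≤ r ≤ 1/16`, zero on the forest), `t ∈ goodTDE` inside the chart window, and `m` with `2(12H²+2H+1)(√2·√(β^{2ε−1}) + 8r) ≤ m ≤ 1/4`:
`|tiltWDE ρ H g β ϑ t| ≤ #(plaquettesTouching Λ)·190·β·m³ + #(ColdFreeIdx H)·ℓ` whenever `|log g(a)| ≤ ℓ` on `‖a‖ ≤ m`. -/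
theorem abs_tiltWDE_le_of_mem_goodTDE (hρ : Continuous ρ) (hinj : Function.Injective ρ) (hH : 1 ≤ H) {β ε r m ℓ : ℝ} (hβ : 0 < β)
    (hr : 0 ≤ r) (hr16 : r ≤ 1 / 16)
    (hm : 2 * ((12 * (H : ℝ) ^ 2 + 2 * H + 1) * (Real.sqrt 2 * Real.sqrt (β ^ (2 * ε - 1)) + 8 * r)) ≤ m) (hm4 : m ≤ 1 / 4)
    {g : EuclideanSpace ℝ (Fin (dimE ρ)) → ℝ} (hg : ∀ a, ‖a‖ ≤ m → |Real.log (g a)| ≤ ℓ)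
    {ϑ : Fin (dimE ρ) → (Literature.MathematicalPhysics.QuantumLattice.ZdEdge 4 → ℝ)}
    (hϑ : ∀ e, e ∉ boxEdges 4 (2 * H + 1) → ∑ c, ϑ c e ^ 2 ≤ r ^ 2)
    (hforest : ∀ x : Site 4, (∀ k : Fin 4, 1 ≤ x k ∧ x k + 1 ≤ 2 * (H : ℤ)) → ∀ c, ϑ c (x, 0) = 0)
    {t : TSpaceD H (dimE ρ)} (hwin : ∀ e : ColdFreeIdx H, ‖unscaleTE H (dimE ρ) β (t + meanTE H (dimE ρ) β ϑ) e‖ ≤ 1 / 16)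
    (ht : t ∈ goodTDE ρ H β ε ϑ) :
    |tiltWDE ρ H g β ϑ t| ≤
      #(plaquettesTouching (boxEdges 4 (2 * H + 1))) * (190 * β * m ^ 3) + Fintype.card (ColdFreeIdx H) * ℓ :=
  abs_tiltWDE_le ρ hρ hβ hm4 hg hforest t
    (fun e => (norm_extDatum_le_of_mem_goodTDE ρ hρu hρ hinj hH hβ hr hr16 hϑ hwin ht e).trans hm)

omit [TopologicalSpace G] [CompactSpace G] in
/-- On `goodTDE`, `β·cost_p(cfgTDE t) < β^{2ε}` for every plaquette touching the box (`β > 0`). -/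
theorem beta_mul_plaqCostAt_lt_of_mem_goodTDE {β ε : ℝ} (hβ : 0 < β)
    {ϑ : Fin (dimE ρ) → (Literature.MathematicalPhysics.QuantumLattice.ZdEdge 4 → ℝ)}
    {t : TSpaceD H (dimE ρ)} (ht : t ∈ goodTDE ρ H β ε ϑ) {p : ZdPlaquette 4} (hp : p ∈ plaquettesTouching (boxEdges 4 (2 * H + 1))) :
    β * plaqCostAt ρ p.1 p.2.1.1 p.2.1.2 (cfgTDE ρ H β ϑ t) < β ^ (2 * ε) := by
  have h := (mem_coldGoodSetG_iff ρ β ε (cfgTDE ρ H β ϑ t)).1 ht p hp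
  have hsplit : β ^ (2 * ε) = β * β ^ (2 * ε - 1) := by
    rw [show (2 : ℝ) * ε = 1 + (2 * ε - 1) by ring, Real.rpow_add hβ, Real.rpow_one]
    ring_nf
  rw [hsplit]
  exact mul_lt_mul_of_pos_left h hβ

omit [TopologicalSpace G] [CompactSpace G] in
include hρu in
/-- On `goodTDE`, `0 ≤ β·cost_p(cfgTDE t) ≤ β^{2ε}` for every plaquette touching the box (unitary-valued `ρ`, `β > 0`). -/
theorem beta_mul_plaqCostAt_mem_Icc_of_mem_goodTDE {β ε : ℝ} (hβ : 0 < β)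
    {ϑ : Fin (dimE ρ) → (Literature.MathematicalPhysics.QuantumLattice.ZdEdge 4 → ℝ)} {t : TSpaceD H (dimE ρ)}
    (ht : t ∈ goodTDE ρ H β ε ϑ) {p : ZdPlaquette 4} (hp : p ∈ plaquettesTouching (boxEdges 4 (2 * H + 1))) :
    0 ≤ β * plaqCostAt ρ p.1 p.2.1.1 p.2.1.2 (cfgTDE ρ H β ϑ t) ∧
      β * plaqCostAt ρ p.1 p.2.1.1 p.2.1.2 (cfgTDE ρ H β ϑ t) ≤ β ^ (2 * ε) := by
  refine ⟨mul_nonneg hβ.le ?_, (beta_mul_plaqCostAt_lt_of_mem_goodTDE ρ hβ ht hp).le⟩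
  rw [plaqCostAt_eq_sub_trace]
  exact sub_nonneg.2 (EquipartitionPinsProbe.TangentCombPoincare.re_trace_le ρ hρu _)

end Chart

end Summit.QuantumFields.YangMills.Theorems.ColdBoxAllGroups

end
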